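import Summits.QuantumFields.BalabanUV.T4Continuum.Support.VariationalCovariantOneStep
import Summits.QuantumFields.BalabanUV.T4Continuum.Support.VariationalCovariantScalarPair

/-!
# T⁴ programme, spine node NE2 (U1a), lane P2 — SUPPLIER LEAF ONE⁺ OF THE VARIATIONAL ROUTE, PART 3: PHYSICAL UNITS AND THE BLOCK-SPIN
# READING in the letters of the capstone `VariationalCovariantScalarPair` (p211992: `Sc`, `Sf`, `qW`, `Q1`) — the supplier's END for `hONE`

NE2 formalisation swarm `b2b-balaban-t4-ne2-formalise-*`, leaf 01 GEN 2 (`prover-b2b-balaban-t4-ne2-formalise-leaf-01-g2-0`), SUPPLIER SEAT for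
leaf ONE⁺ («s5») of the P2 (variational) skeleton `t4/skeletons/NE2-t4-ne2-p2.md` v0.6 §2.C ∕ §7; journal CLAIM CLAIMS.log l.8374 (+ l.8383).
Parts 0–2: `VariationalCovariantWeights`, `VariationalCovariantInterpolant` (the competitor `Λ′ = conj T′ · Φ`, exact constraint, exact bond
identities), `VariationalCovariantOneStep` (lattice END `sum_dirU_interp_le`, main term's constant EXACTLY 1).

HONEST FRAMING (T4-DAG p. 1).  Rung (B)+1 only — NOT infinite volume, NOT a mass gap, NOT Clay.  Node NE2 is NOT IN PRINT and NOT proved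
here.  MODEL LEVEL (U(1) charged scalar = King's model with background; [Balaban1985BackgroundPropagators] (3.3)/(3.19)/(3.23) SHAPES only):
unit coarse bond phases `Rc` (level `n`), fine bond phases `R′` (level `nL`), unit one-step site transports `T′`, and the two ONE-BLOCK
TRANSPORT DEFECTS (in-block `|R′·conj T′(x+e_μ)·T′(x) − 1| ≤ m`, block-crossing `|R′·conj T′(x+e_μ)·T′(x) − Rc(y,μ)| ≤ m`) are DATA; ONE block
step — no `k`, no tower, nothing of node NE3.  OUR statements; nothing printed is a hypothesis; no `def`; no `sorry`; axioms standard.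
HONEST DEPENDENCY (cell, verbatim): continuum YM on T⁴ ⇐ BetaPertH ∧ nine spine estimates (0/9 proved); BetaPertH ⇐ (D1) ∧ (D4) ∧ CAP+tail;
G-an2-4 gates asym, D1 and NE2/3/4.

THE STATEMENTS (`ρ := VariationalCovariantInterpolant.rho n M Rc = n⁴/n^d·Σ_{μ,ν,y}|(D⁺_μD⁺_νλ)(y)|²`, an `H²`-type seminorm of the coarse field):

  `Sf n L M R′ Λ′ ≤ ( √( Sc n M Rc λ + (d/4 + 1/2)·(L/n²)·ρ λ ) + √(2d(1+d²))·(n·L·m)·√(qW n M λ) )²`                  (`Sf_interp_le`)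
  `blockSpin (Q1 n L M T′) (Sf n L M R′) λ ≤ (the same)`                                                              (`blockSpin_Q1_le` = ONE⁺)
  `∃ f′, Q1 n L M T′ f′ = λ ∧ Sf n L M R′ f′ ≤ (the same)`                                                            (`exists_oneStep`)

and for transport-FLAT one-step data (`m = 0`, e.g. `U = 1`) the purely ADDITIVE `blockSpin … λ ≤ Sc λ + (d/4 + 1/2)·(L/n²)·ρ λ + 0·qW λ`
(`blockSpin_Q1_le_flat`) — LITERALLY the capstone's binder `hONE` with `ε₁ = (d/4 + 1/2)·L·n⁻²`, `ε₂ = 0`.  SHAPE NOTE (located before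
proving, journal l.8374): with `m > 0` the honest bound carries the LINEAR cross term `2√(Sc + ε₁ρ)·δ₁√qW`, `δ₁ = √(2d(1+d²))·n·L·m` — first
order in the field strength (the owner's numerics N-ne2p2g10-1: increments `≈ 82·L^{−2k} + 2.4·α·L^{−k}`), which no additive
`Sc + ε₁ρ + ε₂qW` with coefficient 1 on `Sc` absorbs; the consumer handles it at the coarse minimiser by `defect_bound`-type bookkeeping (as
for FED⁺'s `Sc_Q1_le`).  NOT CLAIMED: REG⁺, UB⁺, the model-level identifications, colour, multi-region versions.  NE2 NOT proved; spine 0/9.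
-/

noncomputable section

namespace Summit.QuantumFields.BalabanUV.T4Continuum.VariationalCovariantOneStepPhys

open Finset
open scoped ComplexConjugate
open Literature.MathematicalPhysics.QuantumFieldTheory.Balaban1983to89
open Literature.MathematicalPhysics.QuantumFieldTheory.Balaban1983to89.B5Prop11Plancherel (Tor fine unitVec)
open Literature.MathematicalPhysics.QuantumFieldTheory.Balaban1983to89.B5Prop11Lower (nsq nsq_nonneg)
open Literature.MathematicalPhysics.QuantumFieldTheory.Balaban1983to89.B5Block118 (bpt)
open Summit.QuantumFields.BalabanUV.T4Continuum.VariationalTransfer (blockSpin blockSpin_le)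
open Summit.QuantumFields.BalabanUV.T4Continuum.VariationalCovariantFederbush (cD dirU Qc dirU_nonneg)
open Summit.QuantumFields.BalabanUV.T4Continuum.VariationalCovariantInterpolant (interp hess hess_nonneg rho rho_nonneg Qc_interp)
open Summit.QuantumFields.BalabanUV.T4Continuum.VariationalCovariantOneStep (sum_dirU_interp_le)
open Summit.QuantumFields.BalabanUV.T4Continuum.VariationalCovariantScalarPair (Sc Sf qW Q1 Sc_nonneg Sf_nonneg qW_nonneg)

variable {d : ℕ}

/-! ## §1 Physical units at level `n = L^k`: the capstone's letters `Sc`, `Sf`, `qW`, `Q1` (p211992) and `ρ = rho n M Rc` -/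

section Phys

variable (n L : ℕ) [NeZero n] [NeZero L] (M : Fin d → ℕ) [hM : ∀ μ, NeZero (M μ)]

omit [NeZero n] [NeZero L] hM in
/-- rescaling a `(√P + Q)²` bound: `s·(√P + Q)² = (√(s·P) + √s·Q)²` for `s, P ≥ 0`. [folklore] -/
theorem scale_sq_sqrt_add {s P Q : ℝ} (hs : 0 ≤ s) :
    s * (Real.sqrt P + Q) ^ 2 = (Real.sqrt (s * P) + Real.sqrt s * Q) ^ 2 := by
  rw [Real.sqrt_mul hs P]
  have h : Real.sqrt s ^ 2 = s := Real.sq_sqrt hs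
  nlinarith [h]

/-- **LEAF ONE⁺ (physical units)**: the fine covariant Dirichlet FORM of the competitor against the coarse form, the regularity functional
`ρ` and the `L²` size of the coarse field:
`Sf(Λ′) ≤ ( √( Sc λ + (d/4 + 1/2)·(L/n²)·ρ λ ) + √(2d(1+d²))·(n·L·m)·√(qW λ) )²`. [folklore] -/
theorem Sf_interp_le {Rc : Tor (fine n M) → Fin d → ℂ} {R' : Tor (fine L (fine n M)) → Fin d → ℂ} {T' : Tor (fine L (fine n M)) → ℂ}
    (hT1 : ∀ x, ‖T' x‖ = 1) (hRc1 : ∀ y μ, ‖Rc y μ‖ = 1) {m : ℝ} (hm : 0 ≤ m)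
    (hin : ∀ (y : Tor (fine n M)) (j : Fin d → Fin L) (μ : Fin d), (j μ : ℕ) + 1 < L →
      ‖R' (bpt L (fine n M) y j) μ * conj (T' (bpt L (fine n M) y j + unitVec (fine L (fine n M)) μ)) * T' (bpt L (fine n M) y j) - 1‖ ≤ m)
    (hcross : ∀ (y : Tor (fine n M)) (j : Fin d → Fin L) (μ : Fin d), (j μ : ℕ) + 1 = L →
      ‖R' (bpt L (fine n M) y j) μ * conj (T' (bpt L (fine n M) y j + unitVec (fine L (fine n M)) μ)) * T' (bpt L (fine n M) y j)
        - Rc y μ‖ ≤ m)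
    (lam : Tor (fine n M) → ℂ) :
    Sf n L M R' (interp L (fine n M) T' Rc lam)
      ≤ (Real.sqrt (Sc n M Rc lam + ((d : ℝ) / 4 + 1 / 2) * ((L : ℝ) / (n : ℝ) ^ 2) * rho n M Rc lam)
          + Real.sqrt (2 * d * (1 + (d : ℝ) ^ 2)) * ((n : ℝ) * L * m) * Real.sqrt (qW n M lam)) ^ 2 := by
  have hn : (0 : ℝ) < n := by exact_mod_cast Nat.pos_of_ne_zero (NeZero.ne n)
  have hL : (0 : ℝ) < L := by exact_mod_cast Nat.pos_of_ne_zero (NeZero.ne L)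
  have hnd : (0 : ℝ) < (n : ℝ) ^ d := pow_pos hn d
  have hLd : (0 : ℝ) < (L : ℝ) ^ d := pow_pos hL d
  have hnLd : (0 : ℝ) < ((n : ℝ) * L) ^ d := pow_pos (mul_pos hn hL) d
  have hs0 : 0 ≤ ((n : ℝ) * L) ^ 2 / ((n : ℝ) * L) ^ d := by positivity
  have hX0 : 0 ≤ ∑ μ, dirU (fine n M) Rc lam μ := Finset.sum_nonneg fun μ _ => dirU_nonneg _ _ _ _
  have hH0 : 0 ≤ hess (fine n M) Rc lam := hess_nonneg _ _ _
  have hY0 : 0 ≤ nsq lam := nsq_nonneg _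
  -- the lattice bound
  have hlat := sum_dirU_interp_le L (fine n M) (Rc := Rc) (lam := lam) hT1 hRc1 hm hin hcross
  -- `Sf = s·Σ_μ dirU`
  have hSf : Sf n L M R' (interp L (fine n M) T' Rc lam)
      = ((n : ℝ) * L) ^ 2 / ((n : ℝ) * L) ^ d * ∑ μ, dirU (fine L (fine n M)) R' (interp L (fine n M) T' Rc lam) μ := rfl
  -- the rescaled pieces
  have hsP : ((n : ℝ) * L) ^ 2 / ((n : ℝ) * L) ^ d
        * ((L : ℝ) ^ d / (L : ℝ) ^ 2 * (∑ μ, dirU (fine n M) Rc lam μ) + ((d : ℝ) / 4 + 1 / 2) * ((L : ℝ) ^ d / L) * hess (fine n M) Rc lam)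
      = Sc n M Rc lam + ((d : ℝ) / 4 + 1 / 2) * ((L : ℝ) / (n : ℝ) ^ 2) * rho n M Rc lam := by
    have hSc : Sc n M Rc lam = (n : ℝ) ^ 2 / (n : ℝ) ^ d * ∑ μ, dirU (fine n M) Rc lam μ := rfl
    have hrho : rho n M Rc lam = (n : ℝ) ^ 4 / (n : ℝ) ^ d * hess (fine n M) Rc lam := rfl
    rw [hSc, hrho, mul_pow]
    field_simp
    ring
  have hsQ : Real.sqrt (((n : ℝ) * L) ^ 2 / ((n : ℝ) * L) ^ d)
        * (Real.sqrt d * (m * Real.sqrt (2 * (1 + (d : ℝ) ^ 2) * ((L : ℝ) ^ d * nsq lam))))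
      = Real.sqrt (2 * d * (1 + (d : ℝ) ^ 2)) * ((n : ℝ) * L * m) * Real.sqrt (qW n M lam) := by
    have hqW : qW n M lam = ((n : ℝ) ^ d)⁻¹ * nsq lam := rfl
    have e1 : ((n : ℝ) * L) ^ 2 / ((n : ℝ) * L) ^ d * ((L : ℝ) ^ d * nsq lam) = ((n : ℝ) * L) ^ 2 * qW n M lam := by
      rw [hqW]; field_simp; ring
    have e2 : Real.sqrt (((n : ℝ) * L) ^ 2 / ((n : ℝ) * L) ^ d) * Real.sqrt ((L : ℝ) ^ d * nsq lam)
        = (n : ℝ) * L * Real.sqrt (qW n M lam) := by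
      rw [← Real.sqrt_mul hs0, e1, Real.sqrt_mul (sq_nonneg _), Real.sqrt_sq (by positivity)]
    have e3 : Real.sqrt (2 * (1 + (d : ℝ) ^ 2) * ((L : ℝ) ^ d * nsq lam))
        = Real.sqrt (2 * (1 + (d : ℝ) ^ 2)) * Real.sqrt ((L : ℝ) ^ d * nsq lam) := Real.sqrt_mul (by positivity) _
    have e4 : Real.sqrt (2 * d * (1 + (d : ℝ) ^ 2)) = Real.sqrt d * Real.sqrt (2 * (1 + (d : ℝ) ^ 2)) := by
      rw [← Real.sqrt_mul (Nat.cast_nonneg d)]; congr 1; ring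
    rw [e3, e4]
    calc Real.sqrt (((n : ℝ) * L) ^ 2 / ((n : ℝ) * L) ^ d)
          * (Real.sqrt d * (m * (Real.sqrt (2 * (1 + (d : ℝ) ^ 2)) * Real.sqrt ((L : ℝ) ^ d * nsq lam))))
        = Real.sqrt d * Real.sqrt (2 * (1 + (d : ℝ) ^ 2)) * m
            * (Real.sqrt (((n : ℝ) * L) ^ 2 / ((n : ℝ) * L) ^ d) * Real.sqrt ((L : ℝ) ^ d * nsq lam)) := by ring
      _ = _ := by rw [e2]; ring
  rw [hSf]
  refine (mul_le_mul_of_nonneg_left hlat hs0).trans (le_of_eq ?_)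
  rw [scale_sq_sqrt_add hs0, hsP, hsQ]

/-- **LEAF ONE⁺ — THE BLOCK-SPIN READING (the supplier's END for P2's capstone)**: the one-step effective action of the fine covariant form
at the coarse field `λ`, `T_{Q₁} Sf (λ) = inf {Sf f′ : Q_{T′} f′ = λ}`, is at most
`( √( Sc λ + (d/4 + 1/2)·(L/n²)·ρ λ ) + √(2d(1+d²))·(n·L·m)·√(qW λ) )²` — one-step consistency at the coarse field with the main term's
constant EXACTLY 1, a second-order regularity defect `ε₁·ρ`, `ε₁ = (d/4 + 1/2)·L·n⁻²`, and the one-step transport defects entering only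
through `m`, linearly inside the square (honest shape: mirrors FED⁺'s `Sc_Q1_le`).  Unit transports, unit coarse phases; every torus,
every level; NO `k`, NO NE3. [folklore] -/
theorem blockSpin_Q1_le {Rc : Tor (fine n M) → Fin d → ℂ} {R' : Tor (fine L (fine n M)) → Fin d → ℂ} {T' : Tor (fine L (fine n M)) → ℂ}
    (hT1 : ∀ x, ‖T' x‖ = 1) (hRc1 : ∀ y μ, ‖Rc y μ‖ = 1) {m : ℝ} (hm : 0 ≤ m)
    (hin : ∀ (y : Tor (fine n M)) (j : Fin d → Fin L) (μ : Fin d), (j μ : ℕ) + 1 < L →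
      ‖R' (bpt L (fine n M) y j) μ * conj (T' (bpt L (fine n M) y j + unitVec (fine L (fine n M)) μ)) * T' (bpt L (fine n M) y j) - 1‖ ≤ m)
    (hcross : ∀ (y : Tor (fine n M)) (j : Fin d → Fin L) (μ : Fin d), (j μ : ℕ) + 1 = L →
      ‖R' (bpt L (fine n M) y j) μ * conj (T' (bpt L (fine n M) y j + unitVec (fine L (fine n M)) μ)) * T' (bpt L (fine n M) y j)
        - Rc y μ‖ ≤ m)
    (lam : Tor (fine n M) → ℂ) :
    blockSpin (Q1 n L M T') (Sf n L M R') lam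
      ≤ (Real.sqrt (Sc n M Rc lam + ((d : ℝ) / 4 + 1 / 2) * ((L : ℝ) / (n : ℝ) ^ 2) * rho n M Rc lam)
          + Real.sqrt (2 * d * (1 + (d : ℝ) ^ 2)) * ((n : ℝ) * L * m) * Real.sqrt (qW n M lam)) ^ 2 := by
  have hQ : Q1 n L M T' (interp L (fine n M) T' Rc lam) = lam := Qc_interp L (fine n M) Rc lam hT1
  exact (blockSpin_le (Sf_nonneg n L M R') hQ).trans (Sf_interp_le n L M hT1 hRc1 hm hin hcross lam)

/-- **LEAF ONE⁺, `∃`-form in the capstone's letters**: `∃ f′, Q1 f′ = λ ∧ Sf f′ ≤ (…)²` (the competitor exhibited). [folklore] -/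
theorem exists_oneStep {Rc : Tor (fine n M) → Fin d → ℂ} {R' : Tor (fine L (fine n M)) → Fin d → ℂ} {T' : Tor (fine L (fine n M)) → ℂ}
    (hT1 : ∀ x, ‖T' x‖ = 1) (hRc1 : ∀ y μ, ‖Rc y μ‖ = 1) {m : ℝ} (hm : 0 ≤ m)
    (hin : ∀ (y : Tor (fine n M)) (j : Fin d → Fin L) (μ : Fin d), (j μ : ℕ) + 1 < L →
      ‖R' (bpt L (fine n M) y j) μ * conj (T' (bpt L (fine n M) y j + unitVec (fine L (fine n M)) μ)) * T' (bpt L (fine n M) y j) - 1‖ ≤ m)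
    (hcross : ∀ (y : Tor (fine n M)) (j : Fin d → Fin L) (μ : Fin d), (j μ : ℕ) + 1 = L →
      ‖R' (bpt L (fine n M) y j) μ * conj (T' (bpt L (fine n M) y j + unitVec (fine L (fine n M)) μ)) * T' (bpt L (fine n M) y j)
        - Rc y μ‖ ≤ m)
    (lam : Tor (fine n M) → ℂ) :
    ∃ f' : Tor (fine L (fine n M)) → ℂ, Q1 n L M T' f' = lam ∧
      Sf n L M R' f' ≤ (Real.sqrt (Sc n M Rc lam + ((d : ℝ) / 4 + 1 / 2) * ((L : ℝ) / (n : ℝ) ^ 2) * rho n M Rc lam)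
          + Real.sqrt (2 * d * (1 + (d : ℝ) ^ 2)) * ((n : ℝ) * L * m) * Real.sqrt (qW n M lam)) ^ 2 :=
  ⟨interp L (fine n M) T' Rc lam, Qc_interp L (fine n M) Rc lam hT1, Sf_interp_le n L M hT1 hRc1 hm hin hcross lam⟩

/-- **LEAF ONE⁺ FOR TRANSPORT-FLAT ONE-STEP DATA (`m = 0`, e.g. `U = 1`) — PURELY ADDITIVE**:
`T_{Q₁} Sf (λ) ≤ Sc λ + (d/4 + 1/2)·(L/n²)·ρ λ` — LITERALLY the capstone's binder `hONE` (`VariationalCovariantScalarPair.scalar_pair_bracket`)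
with `ε₁ = (d/4 + 1/2)·L·n⁻²` and `ε₂ = 0`. [folklore] -/
theorem blockSpin_Q1_le_flat {Rc : Tor (fine n M) → Fin d → ℂ} {R' : Tor (fine L (fine n M)) → Fin d → ℂ} {T' : Tor (fine L (fine n M)) → ℂ}
    (hT1 : ∀ x, ‖T' x‖ = 1) (hRc1 : ∀ y μ, ‖Rc y μ‖ = 1)
    (hin : ∀ (y : Tor (fine n M)) (j : Fin d → Fin L) (μ : Fin d), (j μ : ℕ) + 1 < L →
      R' (bpt L (fine n M) y j) μ * conj (T' (bpt L (fine n M) y j + unitVec (fine L (fine n M)) μ)) * T' (bpt L (fine n M) y j) = 1)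
    (hcross : ∀ (y : Tor (fine n M)) (j : Fin d → Fin L) (μ : Fin d), (j μ : ℕ) + 1 = L →
      R' (bpt L (fine n M) y j) μ * conj (T' (bpt L (fine n M) y j + unitVec (fine L (fine n M)) μ)) * T' (bpt L (fine n M) y j) = Rc y μ)
    (lam : Tor (fine n M) → ℂ) :
    blockSpin (Q1 n L M T') (Sf n L M R') lam ≤ Sc n M Rc lam + ((d : ℝ) / 4 + 1 / 2) * ((L : ℝ) / (n : ℝ) ^ 2) * rho n M Rc lam + 0 * qW n M lam := by
  have hin' : ∀ (y : Tor (fine n M)) (j : Fin d → Fin L) (μ : Fin d), (j μ : ℕ) + 1 < L →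
      ‖R' (bpt L (fine n M) y j) μ * conj (T' (bpt L (fine n M) y j + unitVec (fine L (fine n M)) μ)) * T' (bpt L (fine n M) y j) - 1‖ ≤ 0 :=
    fun y j μ h => by rw [hin y j μ h, sub_self, norm_zero]
  have hcross' : ∀ (y : Tor (fine n M)) (j : Fin d → Fin L) (μ : Fin d), (j μ : ℕ) + 1 = L →
      ‖R' (bpt L (fine n M) y j) μ * conj (T' (bpt L (fine n M) y j + unitVec (fine L (fine n M)) μ)) * T' (bpt L (fine n M) y j)
        - Rc y μ‖ ≤ 0 :=
    fun y j μ h => by rw [hcross y j μ h, sub_self, norm_zero]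
  have h := blockSpin_Q1_le n L M hT1 hRc1 le_rfl hin' hcross' lam
  have hP : 0 ≤ Sc n M Rc lam + ((d : ℝ) / 4 + 1 / 2) * ((L : ℝ) / (n : ℝ) ^ 2) * rho n M Rc lam := by
    have := Sc_nonneg n M Rc lam; have := rho_nonneg n M Rc lam; positivity
  rw [mul_zero, mul_zero, zero_mul, add_zero, Real.sq_sqrt hP] at h
  rw [zero_mul, add_zero]
  exact h

end Phys

end Summit.QuantumFields.BalabanUV.T4Continuum.VariationalCovariantOneStepPhys

end
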